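import Mathlib.Geometry.Manifold.Instances.Sphere
import Mathlib.Topology.Homotopy.Equiv
import HarnessLib

/-!
# A branched (non-Hausdorff) smooth 4-sphere: `S⁴` with a coordinate ball attached along an open half-ball

Topic `Literature/Geometry/Manifold` (general infrastructure: the tree's first NON-HAUSDORFF smooth manifold; written by the
standing disprover of crux `ThinCrossSectionExists` of route `SmoothPoincare4/CylinderEntropy` to show that the frame hypothesis
`[T2Space M]` of the SPC4-type items is load-bearing).

Construction.  Fix the stereographic chart `τ` of `S⁴ ⊂ ℝ⁵` at a base point and the open half-ball
`B⁻ = {y ∈ ℝ⁴ | ‖y‖ < 1, y₀ < 0}`.  The type `X := S⁴ ⊕ F`, `F = {y | ‖y‖ < 1, 0 ≤ y₀}` (the flap), carries the atlas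
"all stereographic charts of `S⁴` through the first summand" + "the flap chart" (`τ` on `τ⁻¹(B⁻)`, the identity on `F`, onto the
unit ball); its transition maps are sphere transition maps or identities, so `ChartedSpaceCore` produces a topology and a
`C^∞` structure (`core`, `instIsManifoldX`).  This is the classical branching construction (two sheets glued along an open
set, cf. the line with two origins), arranged so that the second sheet deformation retracts into the first:

* `instSecondCountableX` — three chart domains cover;
* `not_t2Space` — **`X` is not Hausdorff**: the flap origin and its twin in sheet 1 have no disjoint neighbourhoods;
* `homotopyEquiv : X ≃ₕ S⁴` — the fold `X → S⁴` (identity on sheet 1, `τ⁻¹` on the flap) is a homotopy equivalence with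
  homotopy inverse the inclusion of sheet 1; the homotopy `id ≃ ψ₁` pushes, inside the host chart, in the direction `-e₀`
  with a cut-off (`push`, `Ψ`, `ψ`, `continuous_ψ`), so that at time `1` the flap has entirely entered the glued region.

Consumers: load-bearing ("any proof must use `T2Space M`") theorems for items quantifying over Hausdorff manifolds homotopy
equivalent to a sphere (e.g. `Summit.SmoothPoincare4…ThinCrossSectionExists`): an embedding into a Hausdorff space forces
`T2Space`, which `X` lacks although it satisfies every other frame hypothesis.  Everything is proved; no facts, no `Prop`-valued
definitions.

## References
* J. M. Lee, *Introduction to Smooth Manifolds*, 2nd ed. (2013), Problem 1-1 and Example 1.3 context (the line with two origins: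
  locally Euclidean, second countable, not Hausdorff).
* A. Haefliger, G. Reeb, *Variétés (non séparées) à une dimension et structures feuilletées du plan*, Enseign. Math. 3 (1957)
  107–125 (non-Hausdorff manifolds obtained by branching along open sets).
-/

noncomputable section

open scoped Manifold ContDiff Topology
open Set Function Filter

namespace Literature.Geometry.Manifold.BranchedFourSphere

local notation "E⁴" => EuclideanSpace ℝ (Fin 4)
local notation "𝕊⁴" => (Metric.sphere (0 : EuclideanSpace ℝ (Fin 5)) 1)

/-! ### The branched 4-sphere as a `ChartedSpaceCore` -/

/-- Base point of `S⁴`. [folklore] -/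
def np : 𝕊⁴ := ⟨EuclideanSpace.single 0 1, by simp⟩

/-- The stereographic charts of `S⁴` (Mathlib's `chartAt`), abbreviated. [folklore] -/
def σ (v : 𝕊⁴) : OpenPartialHomeomorph 𝕊⁴ E⁴ := chartAt E⁴ v

/-- `dim ℝ⁵ = 4 + 1`, the `Fact` instance Mathlib's sphere charts consume. [folklore] -/
instance factFinrank5 : Fact (Module.finrank ℝ (EuclideanSpace ℝ (Fin 5)) = 4 + 1) := ⟨finrank_euclideanSpace_fin⟩

/-- Mathlib's preferred chart at `v` is the stereographic projection from `-v`. [folklore] -/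
lemma σ_eq (v : 𝕊⁴) : σ v = stereographic' 4 (-v) := rfl

/-- Stereographic charts are onto `ℝ⁴`. [folklore] -/
lemma σ_target (v : 𝕊⁴) : (σ v).target = univ := by
  rw [σ_eq, stereographic'_target]

/-- Every point of `ℝ⁴` is in the target of a stereographic chart. [folklore] -/
lemma mem_σ_target (v : 𝕊⁴) (y : E⁴) : y ∈ (σ v).target := by
  rw [σ_target]; exact mem_univ y

/-- The inverse stereographic projection lands in the chart domain. [folklore] -/
lemma symm_mem_source (v : 𝕊⁴) (y : E⁴) : (σ v).symm y ∈ (σ v).source :=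
  (σ v).map_target (mem_σ_target v y)

/-- `σ ∘ σ⁻¹ = id` on all of `ℝ⁴`. [folklore] -/
@[simp] lemma σ_right_inv (v : 𝕊⁴) (y : E⁴) : σ v ((σ v).symm y) = y :=
  (σ v).right_inv (mem_σ_target v y)

/-- The inverse stereographic projection is continuous on `ℝ⁴`. [folklore] -/
lemma continuous_σ_symm (v : 𝕊⁴) : Continuous (σ v).symm := by
  have h := (σ v).continuousOn_symm
  rw [σ_target] at h
  exact continuousOn_univ.mp h

/-- The host chart of the flap. [folklore] -/
def τ : OpenPartialHomeomorph 𝕊⁴ E⁴ := σ np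

/-- The glued half-ball `B⁻ = {‖y‖ < 1, y₀ < 0}`. [folklore] -/
def Bminus : Set E⁴ := {y | ‖y‖ < 1 ∧ y 0 < 0}

/-- The glued half-ball is open. [folklore] -/
lemma isOpen_Bminus : IsOpen Bminus :=
  (isOpen_lt continuous_norm continuous_const).inter (isOpen_lt (PiLp.continuous_apply 2 _ 0) continuous_const)

/-- The flap: the points of the second sheet that are NOT identified with the first. [folklore] -/
def F : Type := {y : E⁴ // ‖y‖ < 1 ∧ 0 ≤ y 0}

/-- **The branched 4-sphere**: `S⁴` with a second copy of the unit ball of the chart `τ` attached along the open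
half-ball `B⁻` (as a type: the sphere plus the flap points). [folklore] -/
def X : Type := 𝕊⁴ ⊕ F

/-- Sheet 1. [folklore] -/
def inX (x : 𝕊⁴) : X := Sum.inl x
/-- The flap points. [folklore] -/
def flX (y : F) : X := Sum.inr y

/-- Sheet 1 is embedded injectively. [folklore] -/
lemma inX_injective : Injective inX := fun _ _ h => Sum.inl_injective h
/-- The flap is embedded injectively. [folklore] -/
lemma flX_injective : Injective flX := fun _ _ h => Sum.inr_injective h
/-- Sheet-1 points and flap points are distinct points of `X`. [folklore] -/
lemma inX_ne_flX (x : 𝕊⁴) (y : F) : inX x ≠ flX y := Sum.inl_ne_inr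

/-- The flap parametrisation of sheet 2 read in `E⁴`: the would-be inverse of the flap chart. [folklore] -/
def c3inv (y : E⁴) : X := if h : ‖y‖ < 1 ∧ 0 ≤ y 0 then flX ⟨y, h⟩ else inX (τ.symm y)

/-- Below the branch locus the flap parametrisation is sheet 1 read through the host chart. [folklore] -/
lemma c3inv_of_neg {y : E⁴} (hy : y 0 < 0) : c3inv y = inX (τ.symm y) := by
  unfold c3inv; rw [dif_neg (fun h => absurd hy (not_lt.mpr h.2))]

/-- On the closed upper half-ball the flap parametrisation is the flap itself. [folklore] -/
lemma c3inv_of_pos {y : E⁴} (h : ‖y‖ < 1 ∧ 0 ≤ y 0) : c3inv y = flX ⟨y, h⟩ := by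
  unfold c3inv; rw [dif_pos h]

/-- Sheet-1 charts: the stereographic charts through the first summand. [folklore] -/
def cc (v : 𝕊⁴) : PartialEquiv X E⁴ where
  toFun := Sum.elim (σ v) (fun _ => 0)
  invFun y := inX ((σ v).symm y)
  source := inX '' (σ v).source
  target := univ
  map_source' := fun _ _ => mem_univ _
  map_target' := fun y _ => ⟨(σ v).symm y, symm_mem_source v y, rfl⟩
  left_inv' := by
    rintro z ⟨x, hx, rfl⟩
    show inX ((σ v).symm (σ v x)) = inX x
    rw [(σ v).left_inv hx]
  right_inv' := fun y _ => by
    show σ v ((σ v).symm y) = y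
    simp

/-- The flap chart: `τ` on the glued region of sheet 1, the identity on the flap. [folklore] -/
def c3 : PartialEquiv X E⁴ where
  toFun := Sum.elim τ (fun y => y.1)
  invFun := c3inv
  source := inX '' (τ.symm '' Bminus) ∪ Set.range flX
  target := Metric.ball 0 1
  map_source' := by
    rintro z (⟨x, ⟨y, hy, rfl⟩, rfl⟩ | ⟨y, rfl⟩)
    · show τ (τ.symm y) ∈ Metric.ball 0 1
      rw [τ, σ_right_inv, Metric.mem_ball, dist_zero_right]; exact hy.1
    · show y.1 ∈ Metric.ball 0 1
      rw [Metric.mem_ball, dist_zero_right]; exact y.2.1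
  map_target' := by
    intro y hy
    rw [Metric.mem_ball, dist_zero_right] at hy
    by_cases h : ‖y‖ < 1 ∧ 0 ≤ y 0
    · rw [c3inv_of_pos h]; exact Or.inr ⟨_, rfl⟩
    · have hy0 : y 0 < 0 := by by_contra h0; exact h ⟨hy, not_lt.mp h0⟩
      rw [c3inv_of_neg hy0]
      exact Or.inl ⟨τ.symm y, ⟨y, ⟨hy, hy0⟩, rfl⟩, rfl⟩
  left_inv' := by
    rintro z (⟨x, ⟨y, hy, rfl⟩, rfl⟩ | ⟨y, rfl⟩)
    · show c3inv (τ (τ.symm y)) = inX (τ.symm y)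
      rw [τ, σ_right_inv, ← τ, c3inv_of_neg hy.2]
    · show c3inv y.1 = flX y
      rw [c3inv_of_pos y.2]; rfl
  right_inv' := by
    intro y hy
    by_cases h : ‖y‖ < 1 ∧ 0 ≤ y 0
    · show Sum.elim τ (fun y : F => y.1) (c3inv y) = y
      rw [c3inv_of_pos h]; rfl
    · have hy0 : y 0 < 0 := by
        rw [Metric.mem_ball, dist_zero_right] at hy
        by_contra h0; exact h ⟨hy, not_lt.mp h0⟩
      show Sum.elim τ (fun y : F => y.1) (c3inv y) = y
      rw [c3inv_of_neg hy0]
      show τ (τ.symm y) = y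
      rw [τ, σ_right_inv]

/-! Values and sources. -/

/-- Value of a sheet-1 chart on sheet 1. [folklore] -/
@[simp] lemma cc_apply_inX (v : 𝕊⁴) (x : 𝕊⁴) : cc v (inX x) = σ v x := rfl
/-- Inverse of a sheet-1 chart. [folklore] -/
@[simp] lemma cc_symm_apply (v : 𝕊⁴) (y : E⁴) : (cc v).symm y = inX ((σ v).symm y) := rfl
/-- Domain of a sheet-1 chart. [folklore] -/
lemma cc_source (v : 𝕊⁴) : (cc v).source = inX '' (σ v).source := rfl
/-- Sheet-1 charts are onto `ℝ⁴`. [folklore] -/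
lemma cc_target (v : 𝕊⁴) : (cc v).target = univ := rfl
/-- The flap chart on the glued region is the host chart. [folklore] -/
@[simp] lemma c3_apply_inX (x : 𝕊⁴) : c3 (inX x) = τ x := rfl
/-- The flap chart on the flap is the identity. [folklore] -/
@[simp] lemma c3_apply_flX (y : F) : c3 (flX y) = y.1 := rfl
/-- The inverse of the flap chart is `c3inv`. [folklore] -/
lemma c3_symm : (c3.symm : E⁴ → X) = c3inv := rfl
/-- Domain of the flap chart: glued region plus flap. [folklore] -/
lemma c3_source : c3.source = inX '' (τ.symm '' Bminus) ∪ Set.range flX := rfl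
/-- The flap chart is onto the open unit ball. [folklore] -/
lemma c3_target : c3.target = Metric.ball 0 1 := rfl

/-- A sheet-1 point is in a sheet-1 chart domain iff it is in the stereographic domain. [folklore] -/
@[simp] lemma inX_mem_cc_source {v : 𝕊⁴} {x : 𝕊⁴} : inX x ∈ (cc v).source ↔ x ∈ (σ v).source := by
  rw [cc_source]; exact inX_injective.mem_set_image

/-- Flap points are in no sheet-1 chart domain. [folklore] -/
@[simp] lemma flX_not_mem_cc_source {v : 𝕊⁴} {y : F} : flX y ∉ (cc v).source := by
  rw [cc_source]; rintro ⟨x, -, h⟩; exact inX_ne_flX x y h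

/-- The glued region read in the host chart. [folklore] -/
lemma symm_image_Bminus : τ.symm '' Bminus = τ.source ∩ τ ⁻¹' Bminus :=
  τ.symm_image_eq_source_inter_preimage (by rw [τ, σ_target]; exact subset_univ _)

/-- A sheet-1 point is in the flap chart domain iff the host chart maps it into the glued half-ball. [folklore] -/
@[simp] lemma inX_mem_c3_source {x : 𝕊⁴} : inX x ∈ c3.source ↔ x ∈ τ.source ∧ τ x ∈ Bminus := by
  rw [c3_source, mem_union, inX_injective.mem_set_image, symm_image_Bminus]
  constructor
  · rintro (h | ⟨y, hy⟩)
    · exact h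
    · exact absurd hy.symm (inX_ne_flX x y)
  · intro h; exact Or.inl h

/-- Flap points are in the flap chart domain. [folklore] -/
@[simp] lemma flX_mem_c3_source {y : F} : flX y ∈ c3.source := Or.inr ⟨y, rfl⟩

/-! The four types of transition domains and maps. -/

/-- Transition domain between two sheet-1 charts (a sphere transition domain). [folklore] -/
lemma trans_source_cc_cc (v w : 𝕊⁴) :
    ((cc v).symm.trans (cc w)).source = (σ v).symm ⁻¹' (σ w).source := by
  rw [PartialEquiv.trans_source, PartialEquiv.symm_source, cc_target, univ_inter]
  ext y; simp

/-- Transition domain sheet-1 chart → flap chart. [folklore] -/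
lemma trans_source_cc_c3 (v : 𝕊⁴) :
    ((cc v).symm.trans c3).source = (σ v).symm ⁻¹' (τ.source ∩ τ ⁻¹' Bminus) := by
  rw [PartialEquiv.trans_source, PartialEquiv.symm_source, cc_target, univ_inter]
  ext y; simp

/-- Transition domain flap chart → sheet-1 chart: the glued half-ball (meeting the target domain). [folklore] -/
lemma trans_source_c3_cc (v : 𝕊⁴) :
    (c3.symm.trans (cc v)).source = Bminus ∩ τ.symm ⁻¹' (σ v).source := by
  rw [PartialEquiv.trans_source, PartialEquiv.symm_source, c3_target]
  ext y
  simp only [mem_inter_iff, mem_preimage, Metric.mem_ball, dist_zero_right, c3_symm]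
  constructor
  · rintro ⟨hy, hmem⟩
    by_cases h : ‖y‖ < 1 ∧ 0 ≤ y 0
    · rw [c3inv_of_pos h] at hmem; exact absurd hmem flX_not_mem_cc_source
    · have hy0 : y 0 < 0 := by by_contra h0; exact h ⟨hy, not_lt.mp h0⟩
      rw [c3inv_of_neg hy0, inX_mem_cc_source] at hmem
      exact ⟨⟨hy, hy0⟩, hmem⟩
  · rintro ⟨⟨hy, hy0⟩, hmem⟩
    refine ⟨hy, ?_⟩
    rw [c3inv_of_neg hy0, inX_mem_cc_source]; exact hmem

/-- Transition domain of the flap chart with itself: the unit ball. [folklore] -/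
lemma trans_source_c3_c3 : (c3.symm.trans c3).source = Metric.ball 0 1 := by
  rw [PartialEquiv.trans_source, PartialEquiv.symm_source, c3_target]
  ext y
  simp only [mem_inter_iff, mem_preimage, and_iff_left_iff_imp]
  intro hy
  exact c3.map_target hy

/-- Sphere transition maps are `C^∞` (Mathlib's analytic structure on the sphere). [folklore] -/
lemma contDiffOn_sphere_transition (v w : 𝕊⁴) :
    ContDiffOn ℝ ∞ (σ w ∘ (σ v).symm) ((σ v).symm ⁻¹' (σ w).source) := by
  have h := (contDiffGroupoid ∞ (𝓡 4)).compatible (chart_mem_atlas E⁴ v) (chart_mem_atlas E⁴ w)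
  rw [contDiffGroupoid, mem_groupoid_of_pregroupoid] at h
  have h1 := h.1
  simp only [contDiffPregroupoid, modelWithCornersSelf_coe, modelWithCornersSelf_coe_symm,
    Function.comp_id, Function.id_comp, Set.range_id, Set.preimage_id, Set.inter_univ,
    OpenPartialHomeomorph.trans_source, OpenPartialHomeomorph.symm_source, OpenPartialHomeomorph.coe_trans] at h1
  have hs : (σ v).target ∩ (σ v).symm ⁻¹' (σ w).source = (σ v).symm ⁻¹' (σ w).source := by
    rw [σ_target, univ_inter]
  rw [σ, σ] at hs ⊢
  rw [hs] at h1
  exact h1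

/-- Sheet-1/sheet-1 transition maps are `C^∞`. [folklore] -/
lemma contDiffOn_cc_cc (v w : 𝕊⁴) :
    ContDiffOn ℝ ∞ ((cc v).symm.trans (cc w)) ((cc v).symm.trans (cc w)).source := by
  rw [trans_source_cc_cc]
  exact (contDiffOn_sphere_transition v w).congr fun y _ => rfl

/-- Sheet-1/flap transition maps are `C^∞` (restrictions of sphere transitions). [folklore] -/
lemma contDiffOn_cc_c3 (v : 𝕊⁴) :
    ContDiffOn ℝ ∞ ((cc v).symm.trans c3) ((cc v).symm.trans c3).source := by
  rw [trans_source_cc_c3]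
  refine ((contDiffOn_sphere_transition v np).mono ?_).congr fun y _ => rfl
  intro y hy; exact hy.1

/-- Flap/sheet-1 transition maps are `C^∞` (restrictions of sphere transitions). [folklore] -/
lemma contDiffOn_c3_cc (v : 𝕊⁴) :
    ContDiffOn ℝ ∞ (c3.symm.trans (cc v)) (c3.symm.trans (cc v)).source := by
  rw [trans_source_c3_cc]
  refine ((contDiffOn_sphere_transition np v).mono ?_).congr fun y hy => ?_
  · intro y hy; exact hy.2
  · simp only [PartialEquiv.coe_trans, Function.comp_apply, c3_symm, c3inv_of_neg hy.1.2, cc_apply_inX]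
    rfl

/-- The flap/flap transition map is the identity. [folklore] -/
lemma contDiffOn_c3_c3 : ContDiffOn ℝ ∞ (c3.symm.trans c3) (c3.symm.trans c3).source := by
  rw [trans_source_c3_c3]
  refine contDiffOn_id.congr fun y hy => ?_
  simp only [PartialEquiv.coe_trans, Function.comp_apply, id_eq]
  exact c3.right_inv hy

/-- The glued region read in the host chart domain is open. [folklore] -/
lemma isOpen_host : IsOpen (τ.source ∩ τ ⁻¹' Bminus) := τ.isOpen_inter_preimage isOpen_Bminus

/-- **The branched 4-sphere as a charted space without topology.** [folklore] -/
def core : ChartedSpaceCore E⁴ X where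
  atlas := Set.range cc ∪ {c3}
  chartAt := Sum.elim (fun x => cc x) (fun _ => c3)
  mem_chart_source := by
    rintro (x | y)
    · show inX x ∈ (cc x).source
      rw [inX_mem_cc_source]; exact mem_chart_source E⁴ x
    · show flX y ∈ c3.source
      exact flX_mem_c3_source
  chart_mem_atlas := by
    rintro (x | y)
    · exact Or.inl ⟨x, rfl⟩
    · exact Or.inr rfl
  open_source := by
    rintro e e' (⟨v, rfl⟩ | rfl) (⟨w, rfl⟩ | rfl)
    · rw [trans_source_cc_cc]; exact (σ w).open_source.preimage (continuous_σ_symm v)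
    · rw [trans_source_cc_c3]; exact isOpen_host.preimage (continuous_σ_symm v)
    · rw [trans_source_c3_cc]; exact isOpen_Bminus.inter ((σ w).open_source.preimage (continuous_σ_symm np))
    · rw [trans_source_c3_c3]; exact Metric.isOpen_ball
  continuousOn_toFun := by
    rintro e e' (⟨v, rfl⟩ | rfl) (⟨w, rfl⟩ | rfl)
    · exact (contDiffOn_cc_cc v w).continuousOn
    · exact (contDiffOn_cc_c3 v).continuousOn
    · exact (contDiffOn_c3_cc w).continuousOn
    · exact contDiffOn_c3_c3.continuousOn

/-- **The topology of the branched sphere**: generated by the charts (`ChartedSpaceCore.toTopologicalSpace`). [folklore] -/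
instance instTopX : TopologicalSpace X := core.toTopologicalSpace
/-- **The branched sphere is a charted space over `ℝ⁴`** (`ChartedSpaceCore.toChartedSpace`). [folklore] -/
instance instChartedX : ChartedSpace E⁴ X := core.toChartedSpace


/-! ### The `C^∞` structure -/

/-- Every transition map of the core atlas is `C^∞`. [folklore] -/
lemma contDiffOn_trans {e e' : PartialEquiv X E⁴} (he : e ∈ core.atlas) (he' : e' ∈ core.atlas) :
    ContDiffOn ℝ ∞ (e.symm.trans e') (e.symm.trans e').source := by
  rcases he with ⟨v, rfl⟩ | he <;> rcases he' with ⟨w, rfl⟩ | he'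
  · exact contDiffOn_cc_cc v w
  · rw [mem_singleton_iff.mp he']; exact contDiffOn_cc_c3 v
  · rw [mem_singleton_iff.mp he]; exact contDiffOn_c3_cc w
  · rw [mem_singleton_iff.mp he, mem_singleton_iff.mp he']; exact contDiffOn_c3_c3

/-- Members of the atlas of `X` are the core charts. [folklore] -/
lemma mem_atlas_iff {E : OpenPartialHomeomorph X E⁴} :
    E ∈ atlas E⁴ X ↔ ∃ (e : PartialEquiv X E⁴) (he : e ∈ core.atlas), E = core.openPartialHomeomorph e he := by
  change E ∈ ⋃ (e : PartialEquiv X E⁴) (he : e ∈ core.atlas), {core.openPartialHomeomorph e he} ↔ _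
  simp only [mem_iUnion, mem_singleton_iff]

/-- **The branched 4-sphere is a `C^∞` manifold** (all transition maps are sphere transition maps or identities). [folklore] -/
instance instIsManifoldX : IsManifold (𝓡 4) ∞ X where
  compatible := by
    intro E E' hE hE'
    obtain ⟨e, he, rfl⟩ := mem_atlas_iff.mp hE
    obtain ⟨e', he', rfl⟩ := mem_atlas_iff.mp hE'
    rw [contDiffGroupoid, mem_groupoid_of_pregroupoid]
    simp only [contDiffPregroupoid, modelWithCornersSelf_coe, modelWithCornersSelf_coe_symm,
      Function.comp_id, Function.id_comp, Set.range_id, Set.preimage_id, Set.inter_univ]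
    exact ⟨contDiffOn_trans he he', contDiffOn_trans he' he⟩


/-! ### Charts as open partial homeomorphisms; second countability; NOT Hausdorff -/

/-- The sheet-1 charts as open partial homeomorphisms of `X`. [folklore] -/
def Ccc (v : 𝕊⁴) : OpenPartialHomeomorph X E⁴ := core.openPartialHomeomorph (cc v) (Or.inl ⟨v, rfl⟩)
/-- The flap chart as an open partial homeomorphism of `X`. [folklore] -/
def C3 : OpenPartialHomeomorph X E⁴ := core.openPartialHomeomorph c3 (Or.inr rfl)

/-- Value of the bundled sheet-1 chart. [folklore] -/
@[simp] lemma Ccc_apply (v : 𝕊⁴) (z : X) : Ccc v z = cc v z := rfl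
/-- Inverse of the bundled sheet-1 chart. [folklore] -/
@[simp] lemma Ccc_symm_apply (v : 𝕊⁴) (y : E⁴) : (Ccc v).symm y = inX ((σ v).symm y) := rfl
/-- Domain of the bundled sheet-1 chart. [folklore] -/
lemma Ccc_source (v : 𝕊⁴) : (Ccc v).source = (cc v).source := rfl
/-- The bundled sheet-1 chart is onto `ℝ⁴`. [folklore] -/
lemma Ccc_target (v : 𝕊⁴) : (Ccc v).target = univ := rfl
/-- Value of the bundled flap chart. [folklore] -/
@[simp] lemma C3_apply (z : X) : C3 z = c3 z := rfl
/-- Inverse of the bundled flap chart. [folklore] -/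
@[simp] lemma C3_symm_apply (y : E⁴) : C3.symm y = c3inv y := rfl
/-- Domain of the bundled flap chart. [folklore] -/
lemma C3_source : C3.source = c3.source := rfl
/-- Target of the bundled flap chart. [folklore] -/
lemma C3_target : C3.target = Metric.ball 0 1 := rfl

/-- The preferred chart at a sheet-1 point. [folklore] -/
lemma chartAt_inX (x : 𝕊⁴) : chartAt E⁴ (inX x) = Ccc x := rfl
/-- The preferred chart at a flap point. [folklore] -/
lemma chartAt_flX (y : F) : chartAt E⁴ (flX y) = C3 := rfl

/-- Sheet-1 chart domains are open in `X`. [folklore] -/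
lemma isOpen_cc_source (v : 𝕊⁴) : IsOpen (cc v).source := (Ccc v).open_source
/-- The flap chart domain is open in `X`. [folklore] -/
lemma isOpen_c3_source : IsOpen c3.source := C3.open_source

/-- `y ↦ inX ((σ v).symm y)` is continuous `E⁴ → X`. [folklore] -/
lemma continuous_inX_symm (v : 𝕊⁴) : Continuous fun y : E⁴ => inX ((σ v).symm y) := by
  have h := (Ccc v).continuousOn_symm
  rw [Ccc_target] at h
  exact continuousOn_univ.mp h

/-- **Sheet 1 is continuously embedded**: `inX : S⁴ → X` is continuous. [folklore] -/
lemma continuous_inX : Continuous inX := by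
  rw [continuous_iff_continuousAt]
  intro x
  have hx : x ∈ (σ x).source := mem_chart_source E⁴ x
  have heq : (fun x' => inX ((σ x).symm (σ x x'))) =ᶠ[𝓝 x] inX := by
    filter_upwards [(σ x).open_source.mem_nhds hx] with x' hx'
    rw [(σ x).left_inv hx']
  refine ContinuousAt.congr ?_ heq
  exact (continuous_inX_symm x).continuousAt.comp ((σ x).continuousAt hx)

/-- The flap parametrisation is continuous on the region `{y₀ < 0} ∪ {‖y‖ < 1}`. [folklore] -/
lemma continuousOn_c3inv : ContinuousOn c3inv ({y : E⁴ | y 0 < 0} ∪ Metric.ball 0 1) := by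
  have h1 : ContinuousOn c3inv {y : E⁴ | y 0 < 0} := by
    refine ((continuous_inX_symm np).continuousOn).congr fun y hy => ?_
    exact c3inv_of_neg hy
  have h2 : ContinuousOn c3inv (Metric.ball 0 1) := by
    have h := C3.continuousOn_symm
    rw [C3_target] at h
    exact h.congr fun y _ => rfl
  have ho1 : IsOpen {y : E⁴ | y 0 < 0} := isOpen_lt (PiLp.continuous_apply 2 _ 0) continuous_const
  intro y hy
  rcases hy with hy | hy
  · exact (h1.continuousAt (ho1.mem_nhds hy)).continuousWithinAt
  · exact (h2.continuousAt (Metric.isOpen_ball.mem_nhds hy)).continuousWithinAt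

/-- A flap point on the branch locus. [folklore] -/
def fz : F := ⟨0, by simp⟩

/-- **Second countable**: three chart domains cover. [folklore] -/
instance instSecondCountableX : SecondCountableTopology X := by
  refine ChartedSpace.secondCountable_of_countable_cover E⁴ (s := {inX np, inX (-np), flX fz}) ?_
    (Set.toFinite _).countable
  apply eq_univ_of_forall
  rintro (x | y)
  · simp only [mem_iUnion, mem_insert_iff, mem_singleton_iff, exists_prop]
    by_cases hx : x = -np
    · refine ⟨inX (-np), Or.inr (Or.inl rfl), ?_⟩
      rw [chartAt_inX, Ccc_source]
      show inX x ∈ (cc (-np)).source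
      rw [inX_mem_cc_source, hx]; exact mem_chart_source E⁴ (-np)
    · refine ⟨inX np, Or.inl rfl, ?_⟩
      rw [chartAt_inX, Ccc_source]
      show inX x ∈ (cc np).source
      rw [inX_mem_cc_source, σ_eq, stereographic'_source]
      simpa using hx
  · simp only [mem_iUnion, mem_insert_iff, mem_singleton_iff, exists_prop]
    refine ⟨flX fz, Or.inr (Or.inr rfl), ?_⟩
    rw [chartAt_flX, C3_source]
    exact flX_mem_c3_source

/-- The two origins: the branch point read in sheet 1 and in the flap. [folklore] -/
def a₁ : X := inX (τ.symm 0)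
/-- The flap origin. [folklore] -/
def a₂ : X := flX fz

/-- The two origins are distinct points. [folklore] -/
lemma a₁_ne_a₂ : a₁ ≠ a₂ := inX_ne_flX _ _

/-- **`X` is not Hausdorff**: every neighbourhood of the flap origin `a₂` and every neighbourhood of its twin `a₁`
contain a common point `inX (τ⁻¹ y)` with `y₀ < 0` small. [folklore] -/
theorem not_t2Space : ¬ T2Space X := by
  intro hT
  obtain ⟨U, V, hU, hV, haU, hbV, hUV⟩ := t2_separation a₁_ne_a₂
  -- sheet 1: y ↦ inX (τ.symm y) is continuous, = a₁ at 0
  have h1 : (fun y : E⁴ => inX (τ.symm y)) ⁻¹' U ∈ 𝓝 (0 : E⁴) :=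
    (continuous_inX_symm np).continuousAt.preimage_mem_nhds (hU.mem_nhds haU)
  -- flap: c3inv is continuous on the ball, = a₂ at 0
  have h2 : c3inv ⁻¹' V ∈ 𝓝[Metric.ball 0 1] (0 : E⁴) := by
    have hc : ContinuousWithinAt c3inv (Metric.ball 0 1) 0 :=
      continuousOn_c3inv 0 (Or.inr (by simp)) |>.mono subset_union_right
    refine hc.preimage_mem_nhdsWithin' ?_
    have : c3inv 0 = a₂ := c3inv_of_pos ⟨by simp, by simp⟩
    rw [this]
    exact mem_nhdsWithin_of_mem_nhds (hV.mem_nhds hbV)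
  rw [mem_nhdsWithin_iff_exists_mem_nhds_inter] at h2
  obtain ⟨W, hW, hWV⟩ := h2
  obtain ⟨ε, hε, hball⟩ := Metric.mem_nhds_iff.mp (inter_mem h1 hW)
  -- the test point
  set y : E⁴ := EuclideanSpace.single (0 : Fin 4) (-(min ε 1) / 2) with hy
  have hpos : 0 < min ε 1 := lt_min hε one_pos
  have hymin : ‖y‖ = min ε 1 / 2 := by
    rw [hy, PiLp.norm_single, Real.norm_eq_abs, abs_div, abs_neg, abs_of_pos hpos]
    norm_num
  have hyε : y ∈ Metric.ball (0 : E⁴) ε := by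
    rw [Metric.mem_ball, dist_zero_right, hymin]
    have := min_le_left ε 1; linarith
  have hy1 : y ∈ Metric.ball (0 : E⁴) 1 := by
    rw [Metric.mem_ball, dist_zero_right, hymin]
    have := min_le_right ε 1; linarith
  have hy0 : y 0 < 0 := by
    rw [hy, PiLp.single_apply, if_pos rfl]
    linarith
  obtain ⟨hyU, hyW⟩ := hball hyε
  have hyV : c3inv y ∈ V := hWV ⟨hyW, hy1⟩
  rw [c3inv_of_neg hy0] at hyV
  exact Set.disjoint_iff.mp hUV ⟨hyU, hyV⟩


/-! ### `X` is homotopy equivalent to `S⁴` (the flap deformation retracts into sheet 1) -/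

/-- The push direction `e₀`. [folklore] -/
def e0 : E⁴ := EuclideanSpace.single (0 : Fin 4) (1 : ℝ)

/-- `(e₀)₀ = 1`. [folklore] -/
@[simp] lemma e0_apply_zero : e0 0 = 1 := by simp [e0]
/-- `(e₀)ᵢ = 0` for `i ≠ 0`. [folklore] -/
lemma e0_apply_ne {i : Fin 4} (hi : i ≠ 0) : e0 i = 0 := by simp [e0, hi]

/-- A continuous cut-off: `1` on the unit ball, `0` outside the ball of radius `2`. [folklore] -/
def χ (y : E⁴) : ℝ := max 0 (min 1 (2 - ‖y‖))

/-- The cut-off is continuous. [folklore] -/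
lemma continuous_χ : Continuous χ := by unfold χ; fun_prop
/-- The cut-off is non-negative. [folklore] -/
lemma χ_nonneg (y : E⁴) : 0 ≤ χ y := le_max_left _ _
/-- The cut-off is at most `1`. [folklore] -/
lemma χ_le_one (y : E⁴) : χ y ≤ 1 := max_le zero_le_one (min_le_left _ _)
/-- The cut-off is `1` on the closed unit ball. [folklore] -/
lemma χ_eq_one {y : E⁴} (h : ‖y‖ ≤ 1) : χ y = 1 := by
  unfold χ; rw [min_eq_left (by linarith), max_eq_right zero_le_one]
/-- The cut-off vanishes outside the ball of radius `2`. [folklore] -/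
lemma χ_eq_zero {y : E⁴} (h : 2 ≤ ‖y‖) : χ y = 0 := by
  unfold χ; rw [max_eq_left]; exact min_le_of_right_le (by linarith)

/-- The push `y ↦ y - (t⁺ χ(y)) e₀` (clamped at `t ≤ 0` so that everything is globally continuous in `t ∈ ℝ`). [folklore] -/
def push (t : ℝ) (y : E⁴) : E⁴ := y - (max t 0 * χ y) • e0

/-- The push is jointly continuous in `(t, y)`. [folklore] -/
lemma continuous_push : Continuous fun p : ℝ × E⁴ => push p.1 p.2 := by
  unfold push
  have hχ := continuous_χ
  fun_prop

/-- The `0`-th coordinate of the push. [folklore] -/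
lemma push_apply_zero (t : ℝ) (y : E⁴) : push t y 0 = y 0 - max t 0 * χ y := by
  simp [push]

/-- The push only changes the `0`-th coordinate. [folklore] -/
lemma push_apply_ne (t : ℝ) (y : E⁴) {i : Fin 4} (hi : i ≠ 0) : push t y i = y i := by
  simp [push, e0_apply_ne hi]

/-- At time `0` the push is the identity. [folklore] -/
lemma push_zero_left (y : E⁴) : push 0 y = y := by simp [push]

/-- The push does not increase the `0`-th coordinate. [folklore] -/
lemma push_apply_zero_le (t : ℝ) (y : E⁴) : push t y 0 ≤ y 0 := by
  rw [push_apply_zero]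
  have := mul_nonneg (le_max_right t 0) (χ_nonneg y)
  linarith

/-- Outside the ball of radius `2` the push is the identity. [folklore] -/
lemma push_of_two_le {t : ℝ} {y : E⁴} (h : 2 ≤ ‖y‖) : push t y = y := by
  simp [push, χ_eq_zero h]

/-- `|y i| ≤ ‖y‖` in Euclidean space. [folklore] -/
lemma abs_apply_le_norm (y : E⁴) (i : Fin 4) : |y i| ≤ ‖y‖ := by
  have h : ‖y i‖ ^ 2 ≤ ∑ j, ‖y j‖ ^ 2 :=
    Finset.single_le_sum (f := fun j => ‖y j‖ ^ 2) (fun j _ => sq_nonneg _) (Finset.mem_univ i)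
  rw [← EuclideanSpace.norm_sq_eq] at h
  rw [← Real.norm_eq_abs]
  exact (sq_le_sq₀ (norm_nonneg _) (norm_nonneg _)).mp h

/-- A pushed point of the unit ball that is still in the closed upper half-space is still in the unit ball. [folklore] -/
lemma norm_push_lt_one {t : ℝ} {y : E⁴} (hy : ‖y‖ < 1) (h0 : 0 ≤ push t y 0) : ‖push t y‖ < 1 := by
  have hsq : ‖push t y‖ ^ 2 ≤ ‖y‖ ^ 2 := by
    rw [EuclideanSpace.norm_sq_eq, EuclideanSpace.norm_sq_eq]
    refine Finset.sum_le_sum fun i _ => ?_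
    by_cases hi : i = 0
    · subst hi
      rw [Real.norm_eq_abs, Real.norm_eq_abs, abs_of_nonneg h0, sq_abs]
      have h1 := push_apply_zero_le t y
      nlinarith
    · rw [push_apply_ne t y hi]
  have := (sq_le_sq₀ (norm_nonneg _) (norm_nonneg _)).mp hsq
  linarith

/-- For `t ≥ 0` (built in) the pushed points of the unit ball stay in the chart region of `c3inv`. [folklore] -/
lemma push_mem_region {t : ℝ} {y : E⁴} (hy : ‖y‖ < 1) :
    push t y ∈ {y : E⁴ | y 0 < 0} ∪ Metric.ball (0 : E⁴) 1 := by
  by_cases h : push t y 0 < 0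
  · exact Or.inl h
  · right
    rw [Metric.mem_ball, dist_zero_right]
    exact norm_push_lt_one hy (not_lt.mp h)

open scoped Classical in
/-- The deformation on sheet 1: push inside the host chart, identity at the antipode. [folklore] -/
def Ψ (t : ℝ) (x : 𝕊⁴) : 𝕊⁴ := if x ∈ τ.source then τ.symm (push t (τ x)) else x

/-- The sheet-1 deformation inside the host chart. [folklore] -/
lemma Ψ_of_mem {t : ℝ} {x : 𝕊⁴} (hx : x ∈ τ.source) : Ψ t x = τ.symm (push t (τ x)) := by
  unfold Ψ; rw [if_pos hx]

/-- The sheet-1 deformation fixes the antipode. [folklore] -/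
lemma Ψ_of_not_mem {t : ℝ} {x : 𝕊⁴} (hx : x ∉ τ.source) : Ψ t x = x := by
  unfold Ψ; rw [if_neg hx]

/-- At time `0` the sheet-1 deformation is the identity. [folklore] -/
lemma Ψ_zero (x : 𝕊⁴) : Ψ 0 x = x := by
  by_cases hx : x ∈ τ.source
  · rw [Ψ_of_mem hx, push_zero_left, τ.left_inv hx]
  · exact Ψ_of_not_mem hx

/-- Far from the flap (`‖τ x‖ ≥ 2` or at the antipode) nothing moves. [folklore] -/
lemma Ψ_eq_self_of_not_mem_image {t : ℝ} {x : 𝕊⁴} (hx : x ∉ τ.symm '' Metric.closedBall (0 : E⁴) 2) :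
    Ψ t x = x := by
  by_cases hs : x ∈ τ.source
  · rw [Ψ_of_mem hs]
    have h2 : 2 ≤ ‖τ x‖ := by
      by_contra hlt
      refine hx ⟨τ x, ?_, τ.left_inv hs⟩
      rw [Metric.mem_closedBall, dist_zero_right]; linarith
    rw [push_of_two_le h2, τ.left_inv hs]
  · exact Ψ_of_not_mem hs

/-- The sheet-1 deformation is jointly continuous. [folklore] -/
lemma continuous_Ψ : Continuous fun p : ℝ × 𝕊⁴ => Ψ p.1 p.2 := by
  rw [continuous_iff_continuousAt]
  rintro ⟨t, x⟩
  by_cases hx : x ∈ τ.source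
  · -- inside the host chart
    have heq : (fun p : ℝ × 𝕊⁴ => τ.symm (push p.1 (τ p.2))) =ᶠ[𝓝 (t, x)] fun p => Ψ p.1 p.2 := by
      have ho : IsOpen ((univ : Set ℝ) ×ˢ τ.source) := (@isOpen_univ ℝ _).prod τ.open_source
      filter_upwards [ho.mem_nhds ⟨mem_univ t, hx⟩] with p hp
      exact (Ψ_of_mem hp.2).symm
    refine ContinuousAt.congr ?_ heq
    have h3 : ContinuousAt (fun p : ℝ × 𝕊⁴ => (p.1, τ p.2)) (t, x) :=
      continuousAt_fst.prodMk ((τ.continuousAt hx).comp continuousAt_snd)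
    have h4 : ContinuousAt (fun p : ℝ × 𝕊⁴ => push p.1 (τ p.2)) (t, x) :=
      continuous_push.continuousAt.comp h3
    exact (continuous_σ_symm np).continuousAt.comp h4
  · -- at the antipode: identity near it
    have hK : IsClosed (τ.symm '' Metric.closedBall (0 : E⁴) 2) :=
      ((isCompact_closedBall (0 : E⁴) 2).image (continuous_σ_symm np)).isClosed
    have hxK : x ∉ τ.symm '' Metric.closedBall (0 : E⁴) 2 := by
      rintro ⟨y, -, rfl⟩; exact hx (symm_mem_source np y)
    have heq : (fun p : ℝ × 𝕊⁴ => p.2) =ᶠ[𝓝 (t, x)] fun p => Ψ p.1 p.2 := by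
      have ho : IsOpen ((univ : Set ℝ) ×ˢ (τ.symm '' Metric.closedBall (0 : E⁴) 2)ᶜ) :=
        (@isOpen_univ ℝ _).prod hK.isOpen_compl
      filter_upwards [ho.mem_nhds ⟨mem_univ t, hxK⟩] with p hp
      exact (Ψ_eq_self_of_not_mem_image hp.2).symm
    exact ContinuousAt.congr continuousAt_snd heq

/-- **The deformation of the branched sphere**: `Ψ` on sheet 1, the straight push on the flap. [folklore] -/
def ψ (t : ℝ) : X → X := Sum.elim (fun x => inX (Ψ t x)) (fun y => c3inv (push t y.1))

/-- The deformation on sheet 1. [folklore] -/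
lemma ψ_inX (t : ℝ) (x : 𝕊⁴) : ψ t (inX x) = inX (Ψ t x) := rfl
/-- The deformation on the flap. [folklore] -/
lemma ψ_flX (t : ℝ) (y : F) : ψ t (flX y) = c3inv (push t y.1) := rfl

/-- At time `0` the deformation is the identity. [folklore] -/
lemma ψ_zero (z : X) : ψ 0 z = z := by
  rcases z with x | y
  · show ψ 0 (inX x) = inX x
    rw [ψ_inX, Ψ_zero]
  · show ψ 0 (flX y) = flX y
    rw [ψ_flX, push_zero_left, c3inv_of_pos y.2]; rfl

/-- At time `1` everything is in sheet 1. [folklore] -/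
lemma ψ_one_mem_range (z : X) : ψ 1 z ∈ Set.range inX := by
  rcases z with x | y
  · exact ⟨_, rfl⟩
  · show ψ 1 (flX y) ∈ Set.range inX
    rw [ψ_flX]
    have h0 : push 1 y.1 0 < 0 := by
      rw [push_apply_zero, χ_eq_one y.2.1.le, max_eq_left zero_le_one]
      have := abs_apply_le_norm y.1 0
      have := le_abs_self (y.1 0)
      linarith [y.2.1]
    rw [c3inv_of_neg h0]
    exact ⟨_, rfl⟩

/-- On the flap chart the deformation reads `c3inv ∘ push ∘ c3`. [folklore] -/
lemma ψ_eq_on_c3 {t : ℝ} {z : X} (hz : z ∈ c3.source) : ψ t z = c3inv (push t (c3 z)) := by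
  rcases z with x | y
  · have hx := inX_mem_c3_source.mp hz
    show ψ t (inX x) = c3inv (push t (c3 (inX x)))
    rw [ψ_inX, Ψ_of_mem hx.1, c3_apply_inX]
    have h0 : push t (τ x) 0 < 0 := lt_of_le_of_lt (push_apply_zero_le _ _) hx.2.2
    rw [c3inv_of_neg h0]
  · rfl

/-- On a sheet-1 chart the deformation reads `inX ∘ Ψ ∘ σ⁻¹ ∘ cc`. [folklore] -/
lemma ψ_eq_on_cc {t : ℝ} {v : 𝕊⁴} {z : X} (hz : z ∈ (cc v).source) :
    ψ t z = inX (Ψ t ((σ v).symm (cc v z))) := by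
  rcases z with x | y
  · have hx := inX_mem_cc_source.mp hz
    show ψ t (inX x) = inX (Ψ t ((σ v).symm (cc v (inX x))))
    rw [ψ_inX, cc_apply_inX, (σ v).left_inv hx]
  · exact absurd hz flX_not_mem_cc_source

/-- **The deformation is jointly continuous** on `ℝ × X` (chart by chart). [folklore] -/
lemma continuous_ψ : Continuous fun p : ℝ × X => ψ p.1 p.2 := by
  rw [continuous_iff_continuousAt]
  rintro ⟨t, z⟩
  rcases z with x | y
  · -- sheet-1 chart at x
    have hz : inX x ∈ (cc x).source := inX_mem_cc_source.mpr (mem_chart_source E⁴ x)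
    have ho : IsOpen ((univ : Set ℝ) ×ˢ (cc x).source) := (@isOpen_univ ℝ _).prod (isOpen_cc_source x)
    have hG : Continuous fun p : ℝ × E⁴ => inX (Ψ p.1 ((σ x).symm p.2)) :=
      continuous_inX.comp (continuous_Ψ.comp (continuous_fst.prodMk ((continuous_σ_symm x).comp continuous_snd)))
    have hC : ContinuousOn (fun p : ℝ × X => (p.1, cc x p.2)) ((univ : Set ℝ) ×ˢ (cc x).source) :=
      continuousOn_fst.prodMk ((Ccc x).continuousOn.comp continuousOn_snd fun p hp => hp.2)
    have h := (hG.comp_continuousOn hC).congr (fun p hp => ψ_eq_on_cc hp.2)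
    exact h.continuousAt (ho.mem_nhds ⟨mem_univ t, hz⟩)
  · -- flap chart
    have hz : flX y ∈ c3.source := flX_mem_c3_source
    have ho : IsOpen ((univ : Set ℝ) ×ˢ c3.source) := (@isOpen_univ ℝ _).prod isOpen_c3_source
    have hP : ContinuousOn (fun p : ℝ × X => push p.1 (c3 p.2)) ((univ : Set ℝ) ×ˢ c3.source) :=
      continuous_push.comp_continuousOn
        (continuousOn_fst.prodMk (C3.continuousOn.comp continuousOn_snd fun p hp => hp.2))
    have hmaps : MapsTo (fun p : ℝ × X => push p.1 (c3 p.2)) ((univ : Set ℝ) ×ˢ c3.source)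
        ({y : E⁴ | y 0 < 0} ∪ Metric.ball (0 : E⁴) 1) := by
      intro p hp
      have hb : c3 p.2 ∈ Metric.ball (0 : E⁴) 1 := c3.map_source hp.2
      rw [Metric.mem_ball, dist_zero_right] at hb
      exact push_mem_region hb
    have h := (continuousOn_c3inv.comp hP hmaps).congr (fun p hp => ψ_eq_on_c3 hp.2)
    exact h.continuousAt (ho.mem_nhds ⟨mem_univ t, hz⟩)

/-- The fold `X → S⁴`: identity on sheet 1, the host chart on the flap. [folklore] -/
def fold : X → 𝕊⁴ := Sum.elim id (fun y => τ.symm y.1)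

/-- The fold is the identity on sheet 1. [folklore] -/
@[simp] lemma fold_inX (x : 𝕊⁴) : fold (inX x) = x := rfl
/-- The fold on the flap is the host chart inverse. [folklore] -/
@[simp] lemma fold_flX (y : F) : fold (flX y) = τ.symm y.1 := rfl

/-- The fold is continuous (chart by chart). [folklore] -/
lemma continuous_fold : Continuous fold := by
  rw [continuous_iff_continuousAt]
  rintro (x | y)
  · have hz : inX x ∈ (cc x).source := inX_mem_cc_source.mpr (mem_chart_source E⁴ x)
    have h : ContinuousOn (fun z => (σ x).symm (cc x z)) (cc x).source :=
      (continuous_σ_symm x).comp_continuousOn (Ccc x).continuousOn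
    have h' : ContinuousOn fold (cc x).source := h.congr (fun z hz' => ?_)
    · exact h'.continuousAt ((isOpen_cc_source x).mem_nhds hz)
    · rcases z with x' | y'
      · have hx' := inX_mem_cc_source.mp hz'
        show fold (inX x') = (σ x).symm (cc x (inX x'))
        rw [fold_inX, cc_apply_inX, (σ x).left_inv hx']
      · exact absurd hz' flX_not_mem_cc_source
  · have hz : flX y ∈ c3.source := flX_mem_c3_source
    have h : ContinuousOn (fun z => τ.symm (c3 z)) c3.source :=
      (continuous_σ_symm np).comp_continuousOn C3.continuousOn
    have h' : ContinuousOn fold c3.source := h.congr (fun z hz' => ?_)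
    · exact h'.continuousAt (isOpen_c3_source.mem_nhds hz)
    · rcases z with x' | y'
      · have hx' := inX_mem_c3_source.mp hz'
        show fold (inX x') = τ.symm (c3 (inX x'))
        rw [fold_inX, c3_apply_inX, τ.left_inv hx'.1]
      · rfl

/-- At time `1` the deformation has folded `X` into sheet 1. [folklore] -/
lemma inX_fold_ψ_one (z : X) : inX (fold (ψ 1 z)) = ψ 1 z := by
  obtain ⟨x, hx⟩ := ψ_one_mem_range z
  rw [← hx, fold_inX]

/-- The maps as bundled continuous maps. [folklore] -/
def foldC : C(X, 𝕊⁴) := ⟨fold, continuous_fold⟩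
/-- Sheet 1 as a bundled continuous map `S⁴ → X`. [folklore] -/
def inC : C(𝕊⁴, X) := ⟨inX, continuous_inX⟩

-- from here on the deformation is only used through its API
attribute [irreducible] ψ

/-- The deformation, uncurried, is continuous. [folklore] -/
lemma continuous_ψ_uncurry : Continuous (Function.uncurry ψ) := continuous_ψ

/-- The time-`1` deformation is continuous. [folklore] -/
lemma continuous_ψ_one : Continuous (ψ 1) := continuous_ψ_uncurry.uncurry_left 1

/-- The time-`1` deformation as a bundled continuous map. [folklore] -/
def ψ1 : C(X, X) := ⟨ψ 1, continuous_ψ_one⟩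

/-- The deformation restricted to `[0, 1] × X` is continuous. [folklore] -/
lemma continuous_ψI : Continuous fun p : unitInterval × X => ψ (p.1 : ℝ) p.2 := by
  have h : Continuous fun p : unitInterval × X => ((p.1 : ℝ), p.2) :=
    (continuous_subtype_val.comp continuous_fst).prodMk continuous_snd
  exact continuous_ψ_uncurry.comp h

/-- The deformation as a homotopy `id ≃ ψ 1`. [folklore] -/
def homotopyψ : ContinuousMap.Homotopy (ContinuousMap.id X) ψ1 where
  toFun p := ψ (p.1 : ℝ) p.2
  continuous_toFun := continuous_ψI
  map_zero_left z := ψ_zero z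
  map_one_left _ := rfl

/-- **`inX ∘ fold ≃ id`**. [folklore] -/
theorem homotopic_inC_comp_foldC : (inC.comp foldC).Homotopic (ContinuousMap.id X) := by
  have h1 : (ContinuousMap.id X).Homotopic ψ1 := ⟨homotopyψ⟩
  have h2 : ((inC.comp foldC).comp (ContinuousMap.id X)).Homotopic ((inC.comp foldC).comp ψ1) :=
    ContinuousMap.Homotopic.comp (ContinuousMap.Homotopic.refl _) h1
  have h3 : (inC.comp foldC).comp ψ1 = ψ1 := by
    ext1 z; exact inX_fold_ψ_one z
  rw [ContinuousMap.comp_id, h3] at h2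
  exact ContinuousMap.Homotopic.trans h2 (ContinuousMap.Homotopic.symm h1)

/-- **The branched 4-sphere is homotopy equivalent to `S⁴`.** [folklore] -/
def homotopyEquiv : ContinuousMap.HomotopyEquiv X 𝕊⁴ where
  toFun := foldC
  invFun := inC
  left_inv := homotopic_inC_comp_foldC
  right_inv := by
    have : foldC.comp inC = ContinuousMap.id 𝕊⁴ := by ext1 x; rfl
    rw [this]

end Literature.Geometry.Manifold.BranchedFourSphere

end
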